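import Literature.AnabelianGeometry.EtaleTheta.BiKummerRootTwist

/-!
# [EtTh] §4 / Thm 5.7: Prop 4.2 (iv) at the TWISTED pair — `Ψ` transports an `N`-th root to its unit-twist up to a
# COHERENT isomorphism of root diagrams (R192 sequel (2b), proof-only; spec abc-iut-L2-d4 10:13:09Z)

S. Mochizuki, *The étale theta function and its Frobenioid-theoretic manifestations*, Publ. RIMS **45** (2009)
[cite: MochizukiEtTh2009, Prop 4.2 (iv) p.315 (PDF p.89); Rmk 4.3.2 p.318–319 (PDF pp.92–93); Thm 5.7 p.329–330 (PDF
pp.103–104); Lem 5.8 p.331 (PDF p.105)].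

abc-iut cell, layer L2, row R192 sequel (2b) (seat abc-iut-f-121).  PROOF-ONLY over `BiKummerRootTransportAt.lean` (p437236:
`NthRoot.transportAt`) and `BiKummerRootTwist.lean` (`FractionPair.twistUnit`, `NthRoot.twistUnit`).

WHAT IS PROVED (`exists_coherent_transport_twisted`).  Self-equivalence case `h : Thm44Hyp S S` (abc-iut-L2-t3), any domain.  Let
`R = (A_N, B_N, α, β, f_N, (s′_N, s″_N))` be an `N`-th root of `P = (s′, s″)` (`f` on `(A, B)`); let the anchors
`eA : Ψ A ≅ A`, `eB : Ψ B ≅ B` be NORMALISED to the base transport datum with `D_c = 1`: `eA⁻¹ ≫ Ψ s′ ≫ eB = s′`,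
`eA⁻¹ ≫ Ψ s″ ≫ eB = s″ ≫ u` with `u ∈ O^×(B)` THE unit discrepancy (abc-iut-w5-d245's datum; "up to multiplication by a `2l`-th root
of unity", Thm 5.7 — not `u = 1`); let `ũ ∈ O^×(B_N)` lie over `u` (`ũ ≫ β = β ≫ u`, abc-iut-L2-d4's `hroot₁N`, with its birational
clauses); and let Prop 4.2 (iv) hold at the twisted pair `(s′, u ∘ s″)` (`hivP′`; `= Prop42_iv` when `A = A_⊙`, open ⟸ ZetaA L06).
Then Prop 4.2 (iv) applied to the two roots `R.twistUnit ũ` and `R.transportAt … (eA, eB)` of `(s′, u ∘ s″)` yields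
`a : Ψ A_N ≅ A_N`, `b : Ψ B_N ≅ B_N`, `v ∈ μ_N(B_N)` with
  `a⁻¹ ≫ Ψ α ≫ eA = α`, `b⁻¹ ≫ Ψ β ≫ eB = β`, `a⁻¹ ≫ Ψ s′_N ≫ b = s′_N`, `a⁻¹ ≫ Ψ s″_N ≫ b = s″_N ≫ ũ ≫ v`, `Base(a) = ebs⁻¹`
— i.e. (`exists_unit_transport_twisted`) the per-level datum `(a, b, e := 1, D_c := 1, D_p := v·ũ ∈ O^×(B_N))` of abc-iut-L2-d4's
chosen-family capstone (`Sec5Thm57ChosenFamily.lean`: `hT`, `hT′`, `hu`) TOGETHER WITH the compatibility of `(a, b)` with the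
structural maps to the base pair; `he` is then trivial and `hΨα`/`hΨβ` follow by `NthRoot.transition_compat_of_base_compat`
(p435513) when the transitions lie over the base pair and the level-1 structural maps are monomorphisms.
HONEST FRAMING: a kernel-checked consequence of NAMED inputs (Prop 4.2 (iv) at the twisted pair, the Thm 4.4 sub-node laws of
`transportAt`, the normalised anchors, the unit `ũ` over `u` with its birational clauses, the base isomorphism `ebs`); nothing is
asserted for any genuine datum; refereed pre-IUT material; nothing here bears on [IUTchIII] Cor. 3.12 or takes a side.
-/

namespace Literature.AnabelianGeometry.EtaleTheta

open CategoryTheory Opposite Literature.AlgebraicGeometry.Frobenioids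

namespace BiKummerSetting

universe u₀ v₀ u v w

variable {K : Type u₀} [Field K] {D₀ : Type u₀} [Category.{v₀} D₀] {V : FrdIMonoidStub.{w}}
  {X₁ : SemiGraphs.TemperedArithmeticGroup.{u₀} K} {T₁ : RealifiedDivisorMonoids (D₀ := D₀) V}
  {D₁ : Type u} [Category.{v} D₁] {VD₁ : FrdICatStub.{u, v, w} D₁} {S : BiKummerSetting X₁ T₁ D₁ VD₁}

namespace NthRoot

section

variable (h : Thm44Hyp S S) (ψ : ∀ A : S.C, S.biratUnits A ≃* S.biratUnits (h.Ψ.functor.obj A))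
    (pullFrac : ∀ {A A' : S.C} (_ : A' ⟶ A), S.biratUnits A → S.biratUnits A')
    (hpull : ∀ {A A' : S.C} (φ : A' ⟶ A) (f : S.biratUnits A),
      ψ A' (pullFrac φ f) = pullFrac (h.Ψ.functor.map φ) (ψ A f))
    (hii : Thm44_ii h ψ) (h3 : h.PreservesFrobeniusStructure) (h4b : h.PreservesBaseFrobeniusTypeData)
    (h8 : h.PreservesAmple) (h15a : h.PreservesFixedByHA ψ) (h15 : h.PreservesSaturated ψ)
    {A B : S.C} {f : S.biratUnits A} {P : S.FractionPair f B} {N : ℕ+} (R : S.NthRoot f P N pullFrac)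
    -- the unit discrepancy at the base pair and the twisted pair
    (u : Aut B) (hu : u ∈ S.units B) {f' : S.biratUnits A}
    (hfrac : S.fracOf P.num (P.den ≫ u.hom) P.isPreStep_num (S.isPreStep_comp_aut P.isPreStep_den u)
      (S.baseEquivalent_comp_unit P.base_eq hu) = f')
    (hdisj : S.DisjointSupports (S.div P.num) (S.div (P.den ≫ u.hom)))
    -- the normalised anchors (D_c = 1)
    (eA : h.Ψ.functor.obj A ≅ A) (eB : h.Ψ.functor.obj B ≅ B)
    (hnum : eA.inv ≫ h.Ψ.functor.map P.num ≫ eB.hom = P.num)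
    (hden : eA.inv ≫ h.Ψ.functor.map P.den ≫ eB.hom = P.den ≫ u.hom)
    (hf : pullFrac eA.hom f' = ψ A f) (heA : S.IsIsometry eA.hom) (heB : S.IsIsometry eB.hom)
    (hArises : S.ArisesFromBaseFrobeniusPair (R.αData.G.map (h.Ψ.functor.mapAut R.AN))
      (h.Ψ.functor.map R.αData.α₂) (h.Ψ.functor.map R.αData.α₁ ≫ eA.hom))
    (hpull₂ : ∀ {X Y Z : S.C} (φ : X ⟶ Y) (χ : Y ⟶ Z) (g : S.biratUnits Z),
      pullFrac (φ ≫ χ) g = pullFrac φ (pullFrac χ g))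
    -- the unit of `B_N` over `u` and its birational clauses (abc-iut-L2-d4's `hroot₁N`)
    (ut : Aut R.BN) (hut : ut ∈ S.units R.BN) (hover : ut.hom ≫ R.β = R.β ≫ u.hom)
    {root' : S.biratUnits R.AN}
    (hfracN : S.fracOf R.pair.num (R.pair.den ≫ ut.hom) R.pair.isPreStep_num
      (S.isPreStep_comp_aut R.pair.isPreStep_den ut) (S.baseEquivalent_comp_unit R.pair.base_eq hut) = root')
    (hdisjN : S.DisjointSupports (S.div R.pair.num) (S.div (R.pair.den ≫ ut.hom)))
    (hpow : root' ^ (N : ℕ) = pullFrac R.αData.α₁ f')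
    (hsat : S.IsSaturated R.AN N (pullFrac R.αData.α₁ f'))
    -- Prop 4.2 (iv) at the twisted pair
    (hivP' : ∀ (R₁ R₂ : S.NthRoot f' (P.twistUnit u hu hfrac hdisj) N pullFrac)
      (ebs : S.base.obj R₁.AN ≅ S.base.obj R₂.AN), S.base.map R₁.α = ebs.hom ≫ S.base.map R₂.α →
        ∃ (v : S.mu R₁.BN N) (ζA : R₁.AN ≅ R₂.AN) (ζB : R₁.BN ≅ R₂.BN),
          ζA.hom ≫ R₂.pair.num = R₁.pair.num ≫ ζB.hom ∧
          ζA.hom ≫ R₂.pair.den = (R₁.pair.den ≫ (v : Aut R₁.BN).hom) ≫ ζB.hom ∧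
          ζA.hom ≫ R₂.α = R₁.α ∧ ζB.hom ≫ R₂.β = R₁.β ∧ S.base.mapIso ζA = ebs)
    (ebs : S.base.obj R.AN ≅ S.base.obj (h.Ψ.functor.obj R.AN))
    (hebs : S.base.map R.α = ebs.hom ≫ S.base.map (h.Ψ.functor.map R.α ≫ eA.hom))

include ψ hpull hii h3 h4b h8 h15a h15 hfrac hdisj hnum hden hf heA heB hArises hpull₂ hut hover hfracN hdisjN hpow hsat hivP' hebs in
/-- **Prop 4.2 (iv) at the twisted pair `(s′, u ∘ s″)`, applied to `(R.twistUnit ũ, Ψ(R) re-anchored)`: the COHERENT transport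
datum with the unit discrepancy.**  `∃ (a : Ψ A_N ≅ A_N) (b : Ψ B_N ≅ B_N) (v : Aut B_N)`, `v ∈ μ_N(B_N)`, `a⁻¹ ≫ Ψ α ≫ eA = α`,
`b⁻¹ ≫ Ψ β ≫ eB = β`, `a⁻¹ ≫ Ψ s′_N ≫ b = s′_N`, `a⁻¹ ≫ Ψ s″_N ≫ b = (s″_N ≫ ũ) ≫ v`, `Base(a) = ebs⁻¹`.
[cite: MochizukiEtTh2009, Prop 4.2 (iv) p.315 (PDF p.89); Thm 5.7 p.330 (PDF p.104); Rmk 4.3.2 p.318–319 (PDF pp.92–93)] -/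
theorem exists_coherent_transport_twisted :
    ∃ (a : h.Ψ.functor.obj R.AN ≅ R.AN) (b : h.Ψ.functor.obj R.BN ≅ R.BN) (v : Aut R.BN),
      v ∈ S.mu R.BN N ∧
      a.inv ≫ h.Ψ.functor.map R.α ≫ eA.hom = R.α ∧
      b.inv ≫ h.Ψ.functor.map R.β ≫ eB.hom = R.β ∧
      a.inv ≫ h.Ψ.functor.map R.pair.num ≫ b.hom = R.pair.num ∧
      a.inv ≫ h.Ψ.functor.map R.pair.den ≫ b.hom = (R.pair.den ≫ ut.hom) ≫ v.hom ∧
      S.base.mapIso a = ebs.symm := by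
  obtain ⟨v, ζA, ζB, h₁, h₂, h₃, h₄, h₅⟩ := hivP'
    (R.twistUnit u hu hfrac hdisj ut hut hover hfracN hdisjN hpow hsat)
    (R.transportAt h ψ pullFrac hpull hii h3 h4b h8 h15a h15 eA eB (P.twistUnit u hu hfrac hdisj) hnum hden hf heA heB
      hArises hpull₂) ebs hebs
  rw [transportAt_pair_num, twistUnit_pair_num] at h₁
  rw [transportAt_pair_den, twistUnit_pair_den] at h₂
  rw [transportAt_α, twistUnit_α] at h₃
  rw [transportAt_β, twistUnit_β] at h₄
  have h₁' : (ζA.hom : R.AN ⟶ h.Ψ.functor.obj R.AN) ≫ h.Ψ.functor.map R.pair.num =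
      R.pair.num ≫ (ζB.hom : R.BN ⟶ h.Ψ.functor.obj R.BN) := h₁
  have h₂' : (ζA.hom : R.AN ⟶ h.Ψ.functor.obj R.AN) ≫ h.Ψ.functor.map R.pair.den =
      ((R.pair.den ≫ ut.hom) ≫ (v.1 : Aut R.BN).hom) ≫ (ζB.hom : R.BN ⟶ h.Ψ.functor.obj R.BN) := h₂
  have h₃' : (ζA.hom : R.AN ⟶ h.Ψ.functor.obj R.AN) ≫ h.Ψ.functor.map R.α ≫ eA.hom = R.α := h₃
  have h₄' : (ζB.hom : R.BN ⟶ h.Ψ.functor.obj R.BN) ≫ h.Ψ.functor.map R.β ≫ eB.hom = R.β := h₄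
  have h₅' : S.base.mapIso (ζA : R.AN ≅ h.Ψ.functor.obj R.AN) = ebs := h₅
  refine ⟨(ζA : R.AN ≅ h.Ψ.functor.obj R.AN).symm, (ζB : R.BN ≅ h.Ψ.functor.obj R.BN).symm, (v.1 : Aut R.BN), v.2,
    ?_, ?_, ?_, ?_, ?_⟩
  · rw [Iso.symm_inv]; exact h₃'
  · rw [Iso.symm_inv]; exact h₄'
  · rw [Iso.symm_inv, Iso.symm_hom, ← Category.assoc]
    exact (Iso.comp_inv_eq _).mpr h₁'
  · rw [Iso.symm_inv, Iso.symm_hom, ← Category.assoc]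
    exact (Iso.comp_inv_eq _).mpr h₂'
  · rw [← h₅']
    exact Iso.ext rfl

include ψ hpull hii h3 h4b h8 h15a h15 hfrac hdisj hnum hden hf heA heB hArises hpull₂ hut hover hfracN hdisjN hpow hsat hivP' hebs in
/-- **The per-level datum of abc-iut-L2-d4's chosen-family capstone, with the unit discrepancy** — `(a, b, e := 1, D_c := 1,
D_p := v·ũ)`: `hT : a⁻¹ ≫ Ψ s′_N ≫ b = e ≫ s′_N ≫ D_c`, `hT′ : a⁻¹ ≫ Ψ s″_N ≫ b = e ≫ s″_N ≫ D_p`, `hu : D_c⁻¹·D_p ∈ O^×(B_N)`,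
plus the compatibility of `(a, b)` with `α, β` (inputs of `transition_compat_of_base_compat` for `hΨα`/`hΨβ`) and
`Base(a) = ebs⁻¹`. [cite: MochizukiEtTh2009, Thm 5.7 p.330 (PDF p.104); Rmk 4.3.2 p.318–319 (PDF pp.92–93)] -/
theorem exists_unit_transport_twisted :
    ∃ (a : h.Ψ.functor.obj R.AN ≅ R.AN) (b : h.Ψ.functor.obj R.BN ≅ R.BN) (e : R.AN ≅ R.AN) (Dc Dp : Aut R.BN),
      a.inv ≫ h.Ψ.functor.map R.pair.num ≫ b.hom = e.hom ≫ R.pair.num ≫ Dc.hom ∧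
      a.inv ≫ h.Ψ.functor.map R.pair.den ≫ b.hom = e.hom ≫ R.pair.den ≫ Dp.hom ∧
      Dc⁻¹ * Dp ∈ S.units R.BN ∧ e = Iso.refl _ ∧ Dc = 1 ∧ (∃ v ∈ S.mu R.BN N, Dp = v * ut) ∧
      a.inv ≫ h.Ψ.functor.map R.α ≫ eA.hom = R.α ∧ b.inv ≫ h.Ψ.functor.map R.β ≫ eB.hom = R.β ∧
      S.base.mapIso a = ebs.symm := by
  obtain ⟨a, b, v, hv, hα, hβ, hn, hd, hbs⟩ := exists_coherent_transport_twisted h ψ pullFrac hpull hii h3 h4b h8 h15a h15 R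
    u hu hfrac hdisj eA eB hnum hden hf heA heB hArises hpull₂ ut hut hover hfracN hdisjN hpow hsat hivP' ebs hebs
  refine ⟨a, b, Iso.refl _, 1, v * ut, ?_, ?_, ?_, rfl, rfl, ⟨v, hv, rfl⟩, hα, hβ, hbs⟩
  · rw [hn, Iso.refl_hom, Category.id_comp]
    show R.pair.num = R.pair.num ≫ (Iso.refl R.BN).hom
    rw [Iso.refl_hom, Category.comp_id]
  · rw [hd, Iso.refl_hom, Category.id_comp, Category.assoc, Aut.Aut_mul_def, Iso.trans_hom]
  · rw [inv_one, one_mul]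
    exact (S.units R.BN).mul_mem hv.1 hut

end

end NthRoot

end BiKummerSetting

end Literature.AnabelianGeometry.EtaleTheta
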